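import Literature.Barriers.CriticalPhenomena.LongRangeTrivialityOnZ3BubbleAudit
import Literature.Barriers.CriticalPhenomena.LongRangeTrivialityOnZ3TreeDiagram
import Literature.Probability.LatticeModels.HighDimPointwiseTriviality
import HarnessLib

/-!
# Audit (D-0021, generation 3) of `LongRangeTrivialityOnZ3Proofs.lean`: the barrier holds at the
# POINTWISE level — clause (iii) `HasNontrivialU4` of the sub-problem is blocked under the bubble
# condition, for every renormalisation

Barrier catalogue `Literature/Barriers/CriticalPhenomena/` (D-0021), sub-problem `Ising3DConformalLimit`.
Third audit record (refuter, barrier-audit mode, generation 3, 2026-08-15) for the sibling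
`LongRangeTrivialityOnZ3Proofs.lean` (discharge of `panis_variance_bound`) of the barrier
`LongRangeTrivialityOnZ3`, after `LongRangeTrivialityOnZ3ProofsAudit.lean` (generation 1: the discharge
CONFIRMED; the technique class is the extensional `InteractionUniformZ3`; the lower half of the variance
footnote is literally false) and `LongRangeTrivialityOnZ3BubbleAudit.lean` (generation 2: the dividing line
is the bubble condition; the sharpened barrier `BubbleTrivialityOnZ3` is PROVED). Both earlier records, and
the parent block, carry the same reservation — scope caveat (a): the barrier is stated for Panis's SMEARED
observables `T_{f,L,β}` (convergence in distribution, Definition 1.1), whereas clause (iii) of the summit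
conjunct `CritIsing3DConformalLimit` is POINTWISE: a scaling limit `S` of the rescaled correlators
`ρ(δ)ⁿ⟨σ_{[x₁/δ]}⋯σ_{[xₙ/δ]}⟩_{β_c}` (`HasPointwiseScalingLimit`, any renormalisation `ρ`) with
`U₄^S ≢ 0` on non-coincident points (`HasNontrivialU4`). This audit attacks the barrier through that gap —
could an argument aimed at the pointwise clause, with a freely chosen renormalisation `ρ`, slip past an
obstruction formulated for `Σ_L(β_c)^{-1/2}∑f(x/L)σ_x`? — and closes it with a THEOREM: it cannot.

## Verdict: CONFIRMED — and scope caveat (a) is LIFTED at the level of `U₄` (the barrier is wider than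
## claimed, not narrower); the audited discharge `panis_variance_bound_holds` is untouched (it is not even
## needed at the pointwise level)

### A. What the sources print (page level, re-read for this audit)

* Panis, §1.2.1 (arXiv p. 6): "Definition 1.1. A discrete system as above is said to converge in
  distribution to a scaling limit if the collection of random variables `(T_{f,L,β}(σ))_{f∈C_0(ℝ^d)}`
  converges in distribution (in the sense of finite dimensional distributions) as `L` goes to infinity";
  Theorem 1.2: "As a consequence, for `β ≤ β_c`, every sub-sequential scaling limit (in the sense of
  Definition 1.1) of the model is Gaussian"; the four-point Ursell function `U₄^β(x,y,z,t)` and "In dimension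
  `d > 4`, Aizenman [A] was able to conclude the triviality of the scaling limits using the tree diagram bound
  `|U₄^β(x,y,z,t)| ≤ 2∑_{u∈ℤ^d}⟨σ_xσ_u⟩_β⟨σ_yσ_u⟩_β⟨σ_zσ_u⟩_β⟨σ_tσ_u⟩_β`".
  [cite: Panis2023Triviality, Definition 1.1, Theorem 1.2 and the display of U₄^β with the tree diagram bound, p. 6]
* Panis, Remark 1.6 (p. 7): "the bubble condition `B(β_c) < ∞` implies that some of the model's critical
  exponents take their mean-field value. It is also possible to show that the bubble condition (together with
  some monotonicity properties of the two-point function), implies triviality of the scaling limits. We provide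
  a proof of this fact in Appendix"; Theorem 12.2 (p. 51), "The bubble condition implies triviality":
  `lim_{β↗β_c(ρ)} g_σ(ρ,β) = 0`, proved from the tree diagram bound `0 ≤ g_σ ≤ 2χ²/ξ_σ^d` and "Using
  Cauchy–Schwarz inequality one gets `(1) ≤ C₁ε^{d/2}ξ_σ^{d/2}√B(ρ,β_c(ρ))`,
  `(2) ≤ C₂ξ_σ^{d/2}√(B_{Lξ_σ} - B_{εξ_σ})`". [cite: Panis2023Triviality, Remark 1.6 (p. 7) and Theorem 12.2 with its proof (p. 51)]
* Aizenman, CDM 2020 (arXiv:2112.04248): Lemma 8.1, eq. (8.2), p. 25 — the tree diagram bound "for the Ising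
  model on any finite graph, at `h = 0` and `β ≥ 0`"; §10.1, p. 31, eqs. (10.1)–(10.2) — the POINTWISE
  dimension count: under "(i) at `β_c` the two-point function is of comparable values for pairs of sites at
  similar distances, (ii) … `S₂(x,y)` decays by a power law … `≈ C/|x-y|^{d-2+η}`", "for quadruples of points
  at mutual distances of order `L` … `|U₄|/S₄ ≤ C L^d/L^{2(d-2+η)} = C/L^{d-4+2η}`, which for `d > 4`
  vanishes". [cite: AizenmanCDM2020, Lemma 8.1 eq. (8.2) (p. 25) and §10.1 eqs. (10.1)–(10.2) (p. 31)]
  On `ℤ³` with `⟨σ₀σ_x⟩_{β_c} ≲ |x|^{-(3-α)}` (the infrared bound of the family) the exponent `d-4+2η` reads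
  `3 - 2α`: positive exactly for `α < 3/2`, the range of `LongRangeTrivialityOnZ3` — so the printed heuristic
  already predicts that the pointwise clause offers no escape; the theorems below make this unconditional and
  replace both standing assumptions (i)–(ii) by MMS2 and the bubble condition.

### B. What is proved here (all theorems; NO definition, NO named fact — D-0026)

For `d = 3`, a ferromagnetic translation-invariant pair interaction `J ≥ 0`, `β ≥ 0`, MMS2 at `β`
(`⟨σ₀σ_y⟩ ≤ ⟨σ₀σ_x⟩` for `3‖x‖_∞ ≤ ‖y‖_∞`) and a finite bubble `B(β) = ∑ₓ⟨σ₀σ_x⟩²_β`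
(namespace `LongRangeIsing`):

* `abs_ursellFour_le_of_sum_box_le` — the tree diagram bound in real form (from the `ℝ≥0∞` theorem
  `treeDiagramBound_state` of `…TreeDiagram`, weighted random currents);
* `sum_box_prod_four_le_of_summable_sq` — the tree diagram sum under the bubble condition, for a general
  square-summable kernel `G ≥ 0`: `∑_{u∈Λ_L}∏ⱼG(yⱼ-u) ≤ m²(4√B√T + T)`, `T = B - B_{n_A}`, when two factors
  are `≤ m` near each marked point and far from all of them (Cauchy–Schwarz near a marked point — one factor
  in the tail; `2GG ≤ G² + G²` in the tail far away);
* `exists_eventually_rescaled_two_le_of_abs_le_one` — the one consequence of `HasPointwiseScalingLimit` used: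
  `ρ(δ)²G₂([z₀/δ],[z₁/δ]) ≤ M` uniformly on compact sets of non-coincident pairs, for small `δ`;
* `limitConnectedFour_eq_zero_of_summable_sq` — **the pointwise theorem**: every pointwise scaling limit `S`
  of `ρ(δ)ⁿ⟨∏σ_{[xᵢ/δ]}⟩_{J,0,β}`, for ANY `ρ : ℝ → ℝ`, has `U₄^S(x) = 0` at every non-coincident `x`
  (hence `not_hasNontrivialU4_of_summable_sq`). The geometry (compact family of pair configurations, bulk
  versus far region, MMS2 beyond the bulk) is that of the tree's `d ≥ 5` theorem
  `limitConnectedFour_eq_zero_of_hasPointwiseScalingLimit_holds` (`HighDimPointwiseTriviality.lean`), whose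
  lattice-approximation lemmas are reused; the analysis differs: no infrared bound, no lower bound on `ρ`
  (so no non-degeneracy of `S₂`), the bubble tail doing all the work, and `ρ⁴·(M/ρ²)² = M²` exactly;
* at `β_c` (product measure if `β_c = 0`, `mms_two_point_zero`):
  `limitConnectedFour_eq_zero_criticalBeta_of_summable_sq` (general `J`; the hypotheses are EXACTLY those of
  `BubbleTrivialityOnZ3`), `LongRangeTrivialityOnZ3_pointwise` (`J = C₀|x-y|₁^{-3-α}`, `0 < α < 3/2`:
  `¬ HasNontrivialU4 S` for every pointwise limit, by `summable_sq_pairCorrelation_criticalBeta` and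
  `panis_mms_two_point_monotone_holds`), `not_conformalLimitShape_algebraic` (the summit statement
  `CritIsing3DConformalLimit` with `criticalCorr 3` replaced by the member's correlators is FALSE — already its
  last clause), `not_interactionUniformZ3_pointwiseU4` (the property "some pointwise scaling limit has
  `U₄ ≢ 0`" is not interaction-uniform on `Z3Model`), `hasNontrivialU4_member_imp` (for any member with MMS2 —
  the nearest-neighbour one included, granted MMS2 for it in this formalisation — a pointwise limit with
  `U₄ ≢ 0` forces `B(β_c) = ∞`) and `interactionUniformZ3_bubble_pointwiseTriviality`.

### C. Consequences for the parent blocks (text; recorded here in case the docstring edits are not applied)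

`LongRangeTrivialityOnZ3`, scope_caveats (a), and `BubbleTrivialityOnZ3`, scope_caveats (a): append
"AUDIT 2026-08-15, generation 3 (`LongRangeTrivialityOnZ3PointwiseAudit.lean`): at the level of the
connected four-point function the pointwise clause IS covered — under the same hypotheses (in particular for
every `α < 3/2` member) every pointwise scaling limit `S` of `ρ(δ)ⁿ⟨∏σ_{[xᵢ/δ]}⟩_{β_c}`, for ANY
renormalisation `ρ` and without non-degeneracy of `S₂`, has `U₄^S ≡ 0` on non-coincident configurations
(`LongRangeTrivialityOnZ3_pointwise`, `limitConnectedFour_eq_zero_criticalBeta_of_summable_sq`); the summit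
statement's exact shape transported to these members is false (`not_conformalLimitShape_algebraic`). What
remains of (a): the free-boundary box-limit state `LongRangeIsing.state` versus the plus state of
`criticalCorr 3` (equal at `β_c` for the nearest-neighbour model by continuity of the transition — cited, not
bridged), and only `U₄` (not the higher cumulants) of a pointwise limit is addressed."
`evasions_known` (both blocks): "no escape through the pointwise clause or the choice of renormalisation:
a nearest-neighbour proof of clause (iii) must consume `B(β_c) = ∞` (or an input implying it) at the
pointwise level too (`hasNontrivialU4_member_imp`)". A remark for `Sweep1.lean`: the hypotheses `ρ > 0` and
`IsNondegenerateTwoPoint S` of the `d ≥ 5` named fact `limitConnectedFour_eq_zero_of_hasPointwiseScalingLimit`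
are unnecessary (the nearest-neighbour model on `ℤ^d`, `d ≥ 5`, has a finite critical bubble and MMS2), by
the same Cauchy–Schwarz splitting — not pursued here.

### D. Literature (evasion search)

Panis's triviality statements (Theorem 1.2, Corollary 1.11, Theorem 12.2) are all for the smeared notion of
Definition 1.1 or for `g_σ(β)`; the pointwise form is printed only as Aizenman's heuristic dimension count
(CDM 2020, §10.1), whose standing assumption (i) is what MMS2 replaces here. No published argument produces a
non-trivial pointwise `U₄` for a bubble-finite ferromagnet, and none could (theorem above); the open
mechanism is unchanged from generation 2 — converting the nearest-neighbour bubble divergence on `ℤ³`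
(`B_n(β_c) ≥ c√(log n)`) into `U₄ ≢ 0`, i.e. a uniformly positive intersection probability of two critical
random-current clusters with distant sources (Lemma 8.1, eq. (8.1)). [cite: AizenmanCDM2020, Lemma 8.1 eq. (8.1), p. 25] [cite: DuminilCopinPanis2025LowerBounds, Theorem 1.8 and Remark 1.9]

## References

* R. Panis, arXiv:2309.05797 (2023) = Ann. Probab. 54 (2026): §1.2.1 Definition 1.1, Theorem 1.2, `U₄^β`
  and the tree diagram bound (p. 6), Remark 1.6 (p. 7), Corollary 1.11 (p. 8), Theorem 12.2 (p. 51)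
  [Panis2023Triviality] (held; read pp. 5–8, 50–52 for this audit).
* M. Aizenman, CDM 2020, arXiv:2112.04248, Lemma 8.1 eqs. (8.1)–(8.2) (p. 25), §10.1 eqs. (10.1)–(10.2)
  (p. 31) [AizenmanCDM2020] (read pp. 25–32 for this audit).
* H. Duminil-Copin, R. Panis, Commun. Math. Phys. 406 (2025), Theorem 1.8, Remark 1.9
  [DuminilCopinPanis2025LowerBounds] (as read by generations 1–2).
* H. Duminil-Copin, Proc. ICM 2022, §8.1 p. 25, §8.4 pp. 28–29 [DuminilCopinICM2022] (the summit statement).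

## Tree anchors

`treeDiagramBound_state` (`…TreeDiagram`); `pairCorrelation_nonneg/comm/zero_sub`, `abs_pairCorrelation_le_one`
(`…TwoPoint`); `state_zero_pair_eq_ite` (`…Reduction`); `summable_sq_pairCorrelation_criticalBeta` (`…ProofsAudit`);
`panis_mms_two_point_monotone_holds` (`…MMSWalk`); `Z3Model.coupling_nonneg/add`, `not_interactionUniformZ3_of_counterexample`
(`…BubbleAudit`, `…OnZ3`); `latticeApprox_smul_siteVec`, `latticeApprox_comp_two`, `supNorm_latticeApprox_le`,
`norm_rescaled_sub_le_of_supNorm_le`, `le_norm_rescaled_sub_of_lt_supNorm`, `norm_rescaled_le_of_supNorm_le`,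
`pair_mem_nonCoincident`, `continuous_pair_add_toLp`, `add_toLp_ofLp_sub`, `tendsto_tsum_sub_sum_box_atTop`,
`sum_filter_lt_supNorm_le_tsum_sub` (`HighDimPointwiseTriviality`); `spinMonomial`, `HasPointwiseScalingLimit`,
`limitConnectedFour`, `HasNontrivialU4`, `IsNondegenerateTwoPoint`, `IsMoebiusCovariant`; Mathlib:
`Finset.sum_mul_sq_le_sq_mul_sq`, `Real.abs_le_sqrt`, `Real.sqrt_mul`, `two_mul_le_add_sq`, `Finset.prod_mul_prod_compl`,
`ENNReal.tsum_eq_iSup_sum`, `TendstoLocallyUniformlyOn`, `tendsto_nat_floor_atTop`, `tendsto_inv_nhdsGT_zero`,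
`Filter.Tendsto.sqrt`, `squeeze_zero_norm'`, `tendsto_nhds_unique`.
-/

noncomputable section

namespace Literature.Barriers.CriticalPhenomena

open Literature.Probability.LatticeModels Literature.Probability.Percolation Filter Topology Finset
open scoped symmDiff

namespace LongRangeIsing

section Dictionary

variable (J : Site 3 → Site 3 → ℝ) (β : ℝ)

/-- The `n = 2` state correlator of a spin monomial is the two-point function. [folklore] -/
theorem state_spinMonomial_pair (a b : Site 3) :
    state J β 0 (spinMonomial ![a, b]) = pairCorrelation J β a b := by
  rw [pairCorrelation]
  congr 1
  funext σ
  simp [spinMonomial, Fin.prod_univ_two]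

/-- The `n = 4` state correlator of a spin monomial is the four-point function. [folklore] -/
theorem state_spinMonomial_four (y : Fin 4 → Site 3) :
    state J β 0 (spinMonomial y) = fourCorrelation J β (y 0) (y 1) (y 2) (y 3) := by
  rw [fourCorrelation]
  congr 1
  funext σ
  simp [spinMonomial, Fin.prod_univ_four]

/-- `⟨σ₀σ_{-v}⟩ = ⟨σ₀σ_v⟩` for translation-invariant `J ≥ 0`, `β ≥ 0`. [folklore] -/
theorem pairCorrelation_zero_neg (hβ : 0 ≤ β) (hJ : ∀ x y, 0 ≤ J x y)
    (hJt : ∀ a x y, J (x + a) (y + a) = J x y) (v : Site 3) :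
    pairCorrelation J β 0 (-v) = pairCorrelation J β 0 v := by
  rw [← zero_sub v, pairCorrelation_zero_sub J β hβ hJ hJt v 0, pairCorrelation_comm]

/-- `⟨σ_aσ_u⟩ = ⟨σ₀σ_{a-u}⟩` for translation-invariant `J ≥ 0`, `β ≥ 0`. [folklore] -/
theorem pairCorrelation_eq_zero_sub' (hβ : 0 ≤ β) (hJ : ∀ x y, 0 ≤ J x y)
    (hJt : ∀ a x y, J (x + a) (y + a) = J x y) (a u : Site 3) :
    pairCorrelation J β a u = pairCorrelation J β 0 (a - u) := by
  rw [← pairCorrelation_zero_sub J β hβ hJ hJt a u, ← pairCorrelation_zero_neg J β hβ hJ hJt (u - a),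
    neg_sub]

end Dictionary

/-! ### The tree diagram bound in real form -/

section TreeBound

variable (J : Site 3 → Site 3 → ℝ) (β : ℝ)

/-- **Tree diagram bound, real form**: if the finite partial sums `∑_{u∈Λ_L} ∏ⱼ⟨σ_{yⱼ}σ_u⟩` are
bounded by `Bnd`, then `|U₄(y)| ≤ 2·Bnd` (`β ≥ 0`, `J ≥ 0`; from the `ℝ≥0∞` form
`treeDiagramBound_state`). [cite: Panis2023Triviality, §4.2 (tree diagram bound, display after Proposition 4.7)] -/
theorem abs_ursellFour_le_of_sum_box_le (hβ : 0 ≤ β) (hJ : ∀ x y, 0 ≤ J x y) (y : Fin 4 → Site 3)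
    {Bnd : ℝ} (hBnd : ∀ L : ℕ, ∑ u ∈ box 3 L, ∏ j, pairCorrelation J β (y j) u ≤ Bnd) :
    |ursellFour J β (y 0) (y 1) (y 2) (y 3)| ≤ 2 * Bnd := by
  have hG0 : ∀ a u, 0 ≤ pairCorrelation J β a u := pairCorrelation_nonneg J β hβ hJ
  have hP0 : ∀ u, 0 ≤ ∏ j, pairCorrelation J β (y j) u := fun u =>
    Finset.prod_nonneg fun j _ => hG0 _ _
  have hBnd0 : 0 ≤ Bnd := le_trans (Finset.sum_nonneg fun u _ => hP0 u) (hBnd 0)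
  have h := treeDiagramBound_state J β hβ hJ (y 0) (y 1) (y 2) (y 3)
  have hprod : ∀ u : Site 3, ENNReal.ofReal (pairCorrelation J β (y 0) u * pairCorrelation J β (y 1) u *
      pairCorrelation J β (y 2) u * pairCorrelation J β (y 3) u) =
      ENNReal.ofReal (∏ j, pairCorrelation J β (y j) u) := fun u => by
    rw [Fin.prod_univ_four]
  simp_rw [hprod] at h
  have htsum : ∑' u : Site 3, ENNReal.ofReal (∏ j, pairCorrelation J β (y j) u) ≤ ENNReal.ofReal Bnd := by
    rw [ENNReal.tsum_eq_iSup_sum]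
    refine iSup_le fun s => ?_
    obtain ⟨L₀, hL₀⟩ := exists_forall_subset_box 3 s
    calc ∑ u ∈ s, ENNReal.ofReal (∏ j, pairCorrelation J β (y j) u)
        ≤ ∑ u ∈ box 3 L₀, ENNReal.ofReal (∏ j, pairCorrelation J β (y j) u) :=
          Finset.sum_le_sum_of_subset_of_nonneg (hL₀ L₀ le_rfl) fun _ _ _ => zero_le
      _ = ENNReal.ofReal (∑ u ∈ box 3 L₀, ∏ j, pairCorrelation J β (y j) u) :=
          (ENNReal.ofReal_sum_of_nonneg fun u _ => hP0 u).symm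
      _ ≤ ENNReal.ofReal Bnd := ENNReal.ofReal_le_ofReal (hBnd L₀)
  have h2 : ENNReal.ofReal |ursellFour J β (y 0) (y 1) (y 2) (y 3)| ≤ ENNReal.ofReal (2 * Bnd) := by
    calc ENNReal.ofReal |ursellFour J β (y 0) (y 1) (y 2) (y 3)|
        ≤ 2 * ∑' u : Site 3, ENNReal.ofReal (∏ j, pairCorrelation J β (y j) u) := h
      _ ≤ 2 * ENNReal.ofReal Bnd := by gcongr
      _ = ENNReal.ofReal (2 * Bnd) := by
          rw [ENNReal.ofReal_mul (by norm_num : (0:ℝ) ≤ 2), ENNReal.ofReal_ofNat]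
  exact (ENNReal.ofReal_le_ofReal_iff (by positivity)).1 h2

end TreeBound

/-! ### Lattice bookkeeping: shifted square sums against the bubble and its tail -/

section Tails

/-- A shifted finite square sum is at most the full bubble: `∑_{u∈s} G(c-u)² ≤ ∑_v G(v)²`. [folklore] -/
theorem sum_sq_sub_le_tsum {G : Site 3 → ℝ} (hGs : Summable fun v => G v ^ 2) (s : Finset (Site 3))
    (c : Site 3) : ∑ u ∈ s, G (c - u) ^ 2 ≤ ∑' v, G v ^ 2 := by
  classical
  have h1 : ∑ u ∈ s, G (c - u) ^ 2 = ∑ v ∈ s.image (c - ·), G v ^ 2 := by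
    rw [Finset.sum_image (fun u _ v _ h => sub_right_injective h)]
  rw [h1]
  exact hGs.sum_le_tsum _ fun v _ => sq_nonneg _

/-- A shifted finite square sum over sites more than `n` away from `c` is at most the bubble tail
`∑_v G(v)² - ∑_{v∈Λ_n} G(v)²`. [folklore] -/
theorem sum_sq_sub_le_tail {G : Site 3 → ℝ} (hGs : Summable fun v => G v ^ 2) (s : Finset (Site 3))
    (c : Site 3) (n : ℕ) (hs : ∀ u ∈ s, n < Site.supNorm (c - u)) :
    ∑ u ∈ s, G (c - u) ^ 2 ≤ ∑' v, G v ^ 2 - ∑ v ∈ box 3 n, G v ^ 2 := by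
  classical
  have h1 : ∑ u ∈ s, G (c - u) ^ 2 = ∑ v ∈ s.image (c - ·), G v ^ 2 := by
    rw [Finset.sum_image (fun u _ v _ h => sub_right_injective h)]
  obtain ⟨L₀, hL₀⟩ := exists_forall_subset_box 3 (s.image (c - ·))
  have hsub : s.image (c - ·) ⊆ (box 3 L₀).filter (fun v => n < Site.supNorm v) := by
    intro v hv
    refine Finset.mem_filter.2 ⟨hL₀ L₀ le_rfl hv, ?_⟩
    obtain ⟨u, hu, rfl⟩ := Finset.mem_image.1 hv
    exact hs u hu
  rw [h1]
  calc ∑ v ∈ s.image (c - ·), G v ^ 2 ≤ ∑ v ∈ (box 3 L₀).filter (fun v => n < Site.supNorm v), G v ^ 2 :=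
        Finset.sum_le_sum_of_subset_of_nonneg hsub fun _ _ _ => sq_nonneg _
    _ ≤ ∑' v, G v ^ 2 - ∑ v ∈ box 3 n, G v ^ 2 :=
        sum_filter_lt_supNorm_le_tsum_sub (fun _ => sq_nonneg _) hGs L₀ n

/-- The bubble tail is nonnegative. [folklore] -/
theorem tsum_sq_sub_sum_box_nonneg {G : Site 3 → ℝ} (hGs : Summable fun v => G v ^ 2) (n : ℕ) :
    0 ≤ ∑' v, G v ^ 2 - ∑ v ∈ box 3 n, G v ^ 2 := by
  have := sum_filter_lt_supNorm_le_tsum_sub (fun _ => sq_nonneg _) hGs 0 n (S := fun v => G v ^ 2)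
  exact le_trans (Finset.sum_nonneg fun _ _ => sq_nonneg _) this

/-- Two factors out of four: if all factors but those at `p ≠ q` are `≤ m`, then
`∏ⱼ Gⱼ ≤ m² G_p G_q` (`G ≥ 0`). [folklore] -/
theorem prod_four_le_sq_mul {G : Fin 4 → ℝ} (hG0 : ∀ j, 0 ≤ G j) (m : ℝ) (p q : Fin 4)
    (hpq : p ≠ q) (h : ∀ j, j ≠ p → j ≠ q → G j ≤ m) : ∏ j, G j ≤ m ^ 2 * (G p * G q) := by
  classical
  have h1 : ∏ j, G j = (∏ j ∈ ({p, q} : Finset (Fin 4)), G j) * ∏ j ∈ ({p, q} : Finset (Fin 4))ᶜ, G j :=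
    (Finset.prod_mul_prod_compl _ _).symm
  rw [Finset.prod_pair hpq] at h1
  have h2 : ∏ j ∈ ({p, q} : Finset (Fin 4))ᶜ, G j ≤ m ^ 2 := by
    calc ∏ j ∈ ({p, q} : Finset (Fin 4))ᶜ, G j ≤ ∏ _j ∈ ({p, q} : Finset (Fin 4))ᶜ, m :=
          Finset.prod_le_prod (fun j _ => hG0 j) fun j hj => by
            rw [Finset.mem_compl, Finset.mem_insert, Finset.mem_singleton, not_or] at hj
            exact h j hj.1 hj.2
      _ = m ^ 2 := by
          rw [Finset.prod_const, Finset.card_compl, Finset.card_pair hpq, Fintype.card_fin]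
  rw [h1]
  calc G p * G q * ∏ j ∈ ({p, q} : Finset (Fin 4))ᶜ, G j ≤ G p * G q * m ^ 2 :=
        mul_le_mul_of_nonneg_left h2 (mul_nonneg (hG0 p) (hG0 q))
    _ = m ^ 2 * (G p * G q) := by ring

/-- Cauchy–Schwarz for a shifted product against the bubble and its tail:
`∑_{u∈s} G(c-u)G(c'-u) ≤ √B·√T` when the `c'`-shifts stay more than `n` away. [folklore] -/
theorem sum_mul_sub_le_sqrt {G : Site 3 → ℝ} (hGs : Summable fun v => G v ^ 2)
    (s : Finset (Site 3)) (c c' : Site 3) (n : ℕ) (hs : ∀ u ∈ s, n < Site.supNorm (c' - u)) :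
    ∑ u ∈ s, G (c - u) * G (c' - u) ≤
      Real.sqrt (∑' v, G v ^ 2) * Real.sqrt (∑' v, G v ^ 2 - ∑ v ∈ box 3 n, G v ^ 2) := by
  have hcs := Finset.sum_mul_sq_le_sq_mul_sq s (fun u => G (c - u)) (fun u => G (c' - u))
  have h1 := sum_sq_sub_le_tsum hGs s c
  have h2 := sum_sq_sub_le_tail hGs s c' n hs
  have hB0 : 0 ≤ ∑' v, G v ^ 2 := tsum_nonneg fun _ => sq_nonneg _
  have hsq : (∑ u ∈ s, G (c - u) * G (c' - u)) ^ 2 ≤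
      (∑' v, G v ^ 2) * (∑' v, G v ^ 2 - ∑ v ∈ box 3 n, G v ^ 2) :=
    hcs.trans (mul_le_mul h1 h2 (Finset.sum_nonneg fun _ _ => sq_nonneg _) hB0)
  rw [← Real.sqrt_mul hB0]
  exact (le_abs_self _).trans (Real.abs_le_sqrt hsq)

end Tails

/-! ### The two regions of the tree diagram sum under the bubble condition -/

section Regions

/-- **The tree diagram sum under the bubble condition** (the `β = β_c` pointwise form of "the bubble
condition implies triviality"): for `G ≥ 0` square-summable on `ℤ³`, four marked sites `yᵢ` whose
`n_A`-neighbourhoods are disjoint, and a real `m` bounding `G(yⱼ - u)` for `u` near another marked point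
(`j ≠ i`) and `G(y₀ - u), G(y₁ - u)` for `u` far from all of them,
`∑_{u∈Λ_L} ∏ⱼ G(yⱼ-u) ≤ m²(4√B√T + T)`, `B = ∑G²`, `T = ∑_{‖v‖>n_A}G²` — near `yᵢ` two factors are
`≤ m` and the other two are summed by Cauchy–Schwarz (one of them lives in the tail), far away two
factors are `≤ m` and `2G(y₂-u)G(y₃-u) ≤ G(y₂-u)² + G(y₃-u)²` lives in the tail.
[cite: Panis2023Triviality, Theorem 12.2 (the bubble condition implies triviality: Cauchy–Schwarz splitting of the tree diagram), p. 51] -/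
theorem sum_box_prod_four_le_of_summable_sq {G : Site 3 → ℝ} (hG0 : ∀ v, 0 ≤ G v)
    (hGs : Summable fun v => G v ^ 2) (y : Fin 4 → Site 3) (nA : ℕ) (m : ℝ)
    (hsep : ∀ i j, i ≠ j → ∀ u : Site 3, Site.supNorm (u - y i) ≤ nA → nA < Site.supNorm (y j - u))
    (hA : ∀ i j, i ≠ j → ∀ u : Site 3, Site.supNorm (u - y i) ≤ nA → G (y j - u) ≤ m)
    (hF : ∀ u : Site 3, (∀ i, nA < Site.supNorm (u - y i)) → G (y 0 - u) ≤ m ∧ G (y 1 - u) ≤ m)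
    (L : ℕ) :
    ∑ u ∈ box 3 L, ∏ j, G (y j - u) ≤
      m ^ 2 * (4 * (Real.sqrt (∑' v, G v ^ 2) * Real.sqrt (∑' v, G v ^ 2 - ∑ v ∈ box 3 nA, G v ^ 2))
        + (∑' v, G v ^ 2 - ∑ v ∈ box 3 nA, G v ^ 2)) := by
  classical
  -- the partner index `k i ≠ i`
  set k : Fin 4 → Fin 4 := fun i => if i = 0 then 1 else 0 with hk
  have hki : ∀ i, k i ≠ i := by
    intro i
    simp only [hk]
    split_ifs with h
    · rw [h]; decide
    · exact fun h' => h h'.symm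
  set B : ℝ := ∑' v, G v ^ 2 with hB
  set T : ℝ := ∑' v, G v ^ 2 - ∑ v ∈ box 3 nA, G v ^ 2 with hT
  have hT0 : 0 ≤ T := tsum_sq_sub_sum_box_nonneg hGs nA
  -- the two majorants
  set FA : Site 3 → ℝ := fun u =>
    ∑ i, if Site.supNorm (u - y i) ≤ nA then m ^ 2 * (G (y i - u) * G (y (k i) - u)) else 0 with hFA
  set FF : Site 3 → ℝ := fun u =>
    if ∀ i, nA < Site.supNorm (u - y i) then m ^ 2 * (G (y 2 - u) * G (y 3 - u)) else 0 with hFF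
  have hFAterm : ∀ u i, (0 : ℝ) ≤
      if Site.supNorm (u - y i) ≤ nA then m ^ 2 * (G (y i - u) * G (y (k i) - u)) else 0 := by
    intro u i
    split_ifs
    · exact mul_nonneg (sq_nonneg _) (mul_nonneg (hG0 _) (hG0 _))
    · exact le_rfl
  have hFA0 : ∀ u, 0 ≤ FA u := fun u => Finset.sum_nonneg fun i _ => hFAterm u i
  have hFF0 : ∀ u, 0 ≤ FF u := fun u => by
    simp only [hFF]
    split_ifs
    · exact mul_nonneg (sq_nonneg _) (mul_nonneg (hG0 _) (hG0 _))
    · exact le_rfl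
  -- pointwise domination
  have hpt : ∀ u, ∏ j, G (y j - u) ≤ FA u + FF u := by
    intro u
    by_cases hAu : ∃ i, Site.supNorm (u - y i) ≤ nA
    · obtain ⟨i, hi⟩ := hAu
      have h1 : ∏ j, G (y j - u) ≤ m ^ 2 * (G (y i - u) * G (y (k i) - u)) :=
        prod_four_le_sq_mul (fun j => hG0 _) m i (k i) (hki i).symm fun j hj _ => hA i j (Ne.symm hj) u hi
      have h2 : m ^ 2 * (G (y i - u) * G (y (k i) - u)) ≤ FA u := by
        have := Finset.single_le_sum (f := fun i =>
          if Site.supNorm (u - y i) ≤ nA then m ^ 2 * (G (y i - u) * G (y (k i) - u)) else 0)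
          (fun j _ => hFAterm u j) (Finset.mem_univ i)
        simp only [if_pos hi] at this
        exact this
      linarith [hFF0 u]
    · push Not at hAu
      have h1 : ∏ j, G (y j - u) ≤ m ^ 2 * (G (y 2 - u) * G (y 3 - u)) :=
        prod_four_le_sq_mul (fun j => hG0 _) m 2 3 (by decide) fun j hj2 hj3 => by
          obtain ⟨h0, h1⟩ := hF u hAu
          fin_cases j
          · exact h0
          · exact h1
          · exact absurd rfl hj2
          · exact absurd rfl hj3
      have h2 : FF u = m ^ 2 * (G (y 2 - u) * G (y 3 - u)) := by simp only [hFF, if_pos hAu]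
      linarith [hFA0 u]
  -- summing the near majorant
  have hSA : ∑ u ∈ box 3 L, FA u ≤ 4 * (m ^ 2 * (Real.sqrt B * Real.sqrt T)) := by
    simp only [hFA]
    rw [Finset.sum_comm]
    calc ∑ i : Fin 4, ∑ u ∈ box 3 L,
          (if Site.supNorm (u - y i) ≤ nA then m ^ 2 * (G (y i - u) * G (y (k i) - u)) else 0)
        ≤ ∑ _i : Fin 4, m ^ 2 * (Real.sqrt B * Real.sqrt T) := by
          refine Finset.sum_le_sum fun i _ => ?_
          rw [← Finset.sum_filter, ← Finset.mul_sum]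
          refine mul_le_mul_of_nonneg_left ?_ (sq_nonneg _)
          exact sum_mul_sub_le_sqrt hGs _ (y i) (y (k i)) nA
            (fun u hu => hsep i (k i) (hki i).symm u (Finset.mem_filter.1 hu).2)
      _ = 4 * (m ^ 2 * (Real.sqrt B * Real.sqrt T)) := by
          rw [Finset.sum_const, Finset.card_fin]; simp [nsmul_eq_mul]
  -- summing the far majorant
  have hSF : ∑ u ∈ box 3 L, FF u ≤ m ^ 2 * T := by
    simp only [hFF]
    rw [← Finset.sum_filter, ← Finset.mul_sum]
    refine mul_le_mul_of_nonneg_left ?_ (sq_nonneg _)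
    set s := (box 3 L).filter (fun u => ∀ i, nA < Site.supNorm (u - y i)) with hs
    have hfar : ∀ u ∈ s, ∀ i, nA < Site.supNorm (y i - u) := fun u hu i => by
      rw [Site.supNorm_sub_comm]
      exact (Finset.mem_filter.1 hu).2 i
    have h2 := sum_sq_sub_le_tail hGs s (y 2) nA (fun u hu => hfar u hu 2)
    have h3 := sum_sq_sub_le_tail hGs s (y 3) nA (fun u hu => hfar u hu 3)
    calc ∑ u ∈ s, G (y 2 - u) * G (y 3 - u)
        ≤ ∑ u ∈ s, (G (y 2 - u) ^ 2 + G (y 3 - u) ^ 2) / 2 :=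
          Finset.sum_le_sum fun u _ => by nlinarith [two_mul_le_add_sq (G (y 2 - u)) (G (y 3 - u))]
      _ = (∑ u ∈ s, G (y 2 - u) ^ 2 + ∑ u ∈ s, G (y 3 - u) ^ 2) / 2 := by
          rw [← Finset.sum_add_distrib, Finset.sum_div]
      _ ≤ (T + T) / 2 := by gcongr
      _ = T := by ring
  calc ∑ u ∈ box 3 L, ∏ j, G (y j - u) ≤ ∑ u ∈ box 3 L, (FA u + FF u) := Finset.sum_le_sum fun u _ => hpt u
    _ = ∑ u ∈ box 3 L, FA u + ∑ u ∈ box 3 L, FF u := Finset.sum_add_distrib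
    _ ≤ 4 * (m ^ 2 * (Real.sqrt B * Real.sqrt T)) + m ^ 2 * T := add_le_add hSA hSF
    _ = m ^ 2 * (4 * (Real.sqrt B * Real.sqrt T) + T) := by ring

end Regions

/-! ### Consequence of the pointwise scaling-limit hypothesis: bounded rescaled pair correlators -/

section Rescaled

/-- **Uniform boundedness of the rescaled pair correlators on compacts**, for any lattice family with
`|G₂| ≤ 1`: if `G` has a pointwise scaling limit with renormalisation `ρ`, then on every compact set `K`
of non-coincident pairs, `ρ(δ)² G₂([z₀/δ],[z₁/δ]) ≤ M` for all `z ∈ K` and all small `δ > 0`.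
[folklore] -/
theorem exists_eventually_rescaled_two_le_of_abs_le_one {d : ℕ} {G : LatticeCorrFamily d}
    (hG : ∀ y : Fin 2 → Site d, |G 2 y| ≤ 1) {ρ : ℝ → ℝ} {S : CorrFamily d}
    (hlim : HasPointwiseScalingLimit G ρ S)
    {K : Set (Fin 2 → EuclideanSpace ℝ (Fin d))} (hK : IsCompact K) (hKs : K ⊆ NonCoincident d 2) :
    ∃ M : ℝ, ∀ᶠ δ in 𝓝[>] (0 : ℝ), ∀ z ∈ K, ρ δ ^ 2 * G 2 (fun k => latticeApprox δ (z k)) ≤ M := by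
  have hU : TendstoUniformlyOn (rescaledCorrelator G ρ 2) (S 2) (𝓝[>] 0) K :=
    (tendstoLocallyUniformlyOn_iff_forall_isCompact (isOpen_nonCoincident d 2)).1 (hlim 2) K hKs hK
  have h1 : ∀ᶠ δ in 𝓝[>] (0 : ℝ), ∀ z ∈ K, dist (S 2 z) (rescaledCorrelator G ρ 2 δ z) < 1 :=
    Metric.tendstoUniformlyOn_iff.1 hU 1 one_pos
  obtain ⟨δ₁, hδ₁⟩ := h1.exists
  refine ⟨ρ δ₁ ^ 2 + 2, h1.mono fun δ hδ z hz => ?_⟩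
  have hb : rescaledCorrelator G ρ 2 δ₁ z ≤ ρ δ₁ ^ 2 := by
    rw [rescaledCorrelator_apply]
    calc ρ δ₁ ^ 2 * G 2 (fun i => latticeApprox δ₁ (z i))
        ≤ ρ δ₁ ^ 2 * 1 := mul_le_mul_of_nonneg_left ((le_abs_self _).trans (hG _)) (sq_nonneg _)
      _ = ρ δ₁ ^ 2 := mul_one _
  have e1 := abs_sub_lt_iff.1 (Real.dist_eq _ _ ▸ hδ₁ z hz)
  have e2 := abs_sub_lt_iff.1 (Real.dist_eq _ _ ▸ hδ z hz)
  have : rescaledCorrelator G ρ 2 δ z = ρ δ ^ 2 * G 2 (fun k => latticeApprox δ (z k)) := rfl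
  linarith [e1.1, e1.2, e2.1, e2.2]

end Rescaled


/-! ### Pointwise triviality under the bubble condition: `U₄ ≡ 0` for every pointwise scaling limit -/

section Pointwise

variable (J : Site 3 → Site 3 → ℝ) (β : ℝ)

/-- The `n = 2` state correlator of a spin monomial, functional form. [folklore] -/
theorem state_spinMonomial_two_fun (y : Fin 2 → Site 3) :
    state J β 0 (spinMonomial y) = pairCorrelation J β (y 0) (y 1) := by
  rw [pairCorrelation]
  congr 1
  funext σ
  simp [spinMonomial, Fin.prod_univ_two]

/-- **Pointwise triviality on `ℤ³` under the bubble condition.** Let `J ≥ 0` be a translation-invariant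
pair interaction on `ℤ³`, `β ≥ 0`, with Messager–Miracle-Solé monotone two-point function (MMS2:
`⟨σ₀σ_y⟩_β ≤ ⟨σ₀σ_x⟩_β` for `‖y‖_∞ ≥ 3‖x‖_∞`) and finite bubble `B(β) = ∑ₓ⟨σ₀σ_x⟩²_β < ∞`. If the
correlators `⟨∏ᵢσ_{yᵢ}⟩_{J,0,β}`, renormalised by ANY `ρ`, have a pointwise scaling limit `S`
(`HasPointwiseScalingLimit`: `ρ(δ)ⁿ⟨∏σ_{[xᵢ/δ]}⟩ → Sₙ(x)` locally uniformly on non-coincident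
configurations), then the connected four-point function of `S` vanishes identically on non-coincident
points. Proof: `ρ⁴U₄^{lat}([x/δ]) → U₄^S(x)`; the tree diagram bound gives
`|U₄^{lat}(y)| ≤ 2∑_u∏ⱼ⟨σ₀σ_{yⱼ-u}⟩`; uniform convergence on a compact family of pair configurations
bounds `⟨σ₀σ_v⟩ ≤ M/ρ²` at mesoscopic-to-macroscopic `v` (beyond, by MMS2); near a marked point two
factors are `≤ M/ρ²` and the remaining two are summed by Cauchy–Schwarz against `√B·√(B - B_{a/δ})`,
far from all of them two factors are `≤ M/ρ²` and `2⟨⟩⟨⟩ ≤ ⟨⟩² + ⟨⟩²` lies in the tail `B - B_{a/δ}`;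
hence `ρ⁴|U₄^{lat}| ≤ 2M²(4√B√(B-B_{a/δ}) + B - B_{a/δ}) → 0`. Neither the infrared bound nor a lower
bound on `ρ` (non-degeneracy of `S₂`) is used. This is the `β` fixed, `δ → 0` pointwise analogue of
"the bubble condition … implies triviality of the scaling limits" (printed as `g_σ(β) → 0`, `β ↗ β_c`).
[cite: Panis2023Triviality, Remark 1.6 (p. 7) and Theorem 12.2 (p. 51)] [cite: AizenmanCDM2020, Lemma 8.1 eq. (8.2) and §10.1 (tree diagram bound and the dimension count)] -/
theorem limitConnectedFour_eq_zero_of_summable_sq (hβ : 0 ≤ β) (hJ : ∀ x y, 0 ≤ J x y)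
    (hJt : ∀ a x y, J (x + a) (y + a) = J x y)
    (hmms : ∀ x y : Site 3, (3 : ℝ) * ‖x‖ ≤ ‖y‖ → pairCorrelation J β 0 y ≤ pairCorrelation J β 0 x)
    (hB : Summable fun x : Site 3 => pairCorrelation J β 0 x ^ 2)
    {ρ : ℝ → ℝ} {S : CorrFamily 3}
    (hlim : HasPointwiseScalingLimit (fun _ y => state J β 0 (spinMonomial y)) ρ S)
    (x : Fin 4 → EuclideanSpace ℝ (Fin 3)) (hx : x ∈ NonCoincident 3 4) :
    limitConnectedFour S x = 0 := by
  classical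
  have hinj : Function.Injective x := hx
  have hd1 : 1 ≤ 3 := by norm_num
  -- the one-variable kernel `G(v) = ⟨σ₀σ_v⟩`
  obtain ⟨G, hGdef⟩ : ∃ G : Site 3 → ℝ, G = fun v => pairCorrelation J β 0 v := ⟨_, rfl⟩
  have hG0 : ∀ v, 0 ≤ G v := fun v => by rw [hGdef]; exact pairCorrelation_nonneg J β hβ hJ 0 v
  have hGsymm : ∀ v, G (-v) = G v := fun v => by
    rw [hGdef]; exact pairCorrelation_zero_neg J β hβ hJ hJt v
  have hGpair : ∀ a u, pairCorrelation J β a u = G (a - u) := fun a u => by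
    rw [hGdef]; exact pairCorrelation_eq_zero_sub' J β hβ hJ hJt a u
  have hGs : Summable fun v => G v ^ 2 := by rw [hGdef]; exact hB
  have hMMS : ∀ v w : Site 3, 3 * Site.supNorm w ≤ Site.supNorm v → G v ≤ G w := by
    intro v w h
    rw [hGdef]
    apply hmms
    rw [Site.norm_eq_supNorm, Site.norm_eq_supNorm]
    exact_mod_cast h
  /- Step 1: the rescaled lattice `U₄` at `yᵢ = [xᵢ/δ]` converges to `limitConnectedFour S x`. -/
  set Gf : LatticeCorrFamily 3 := fun _ y => state J β 0 (spinMonomial y) with hGf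
  set U : ℝ → ℝ := fun δ => ρ δ ^ 4 * (Gf 4 (fun i => latticeApprox δ (x i)) -
      (Gf 2 ![latticeApprox δ (x 0), latticeApprox δ (x 1)] * Gf 2 ![latticeApprox δ (x 2), latticeApprox δ (x 3)]
        + Gf 2 ![latticeApprox δ (x 0), latticeApprox δ (x 2)] * Gf 2 ![latticeApprox δ (x 1), latticeApprox δ (x 3)]
        + Gf 2 ![latticeApprox δ (x 0), latticeApprox δ (x 3)] * Gf 2 ![latticeApprox δ (x 1), latticeApprox δ (x 2)]))
    with hU
  have hpair : ∀ i j, i ≠ j → Tendsto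
      (fun δ => ρ δ ^ 2 * Gf 2 ![latticeApprox δ (x i), latticeApprox δ (x j)]) (𝓝[>] 0) (𝓝 (S 2 ![x i, x j])) := by
    intro i j hij
    have hmem : (![x i, x j] : Fin 2 → EuclideanSpace ℝ (Fin 3)) ∈ NonCoincident 3 2 :=
      pair_mem_nonCoincident fun h => hij (hinj h)
    refine Tendsto.congr (fun δ => ?_) ((hlim 2).tendsto_at hmem)
    rw [rescaledCorrelator_apply, latticeApprox_comp_two]
    rfl
  have hU_tendsto : Tendsto U (𝓝[>] 0) (𝓝 (limitConnectedFour S x)) := by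
    have h4 : Tendsto (fun δ => ρ δ ^ 4 * Gf 4 (fun i => latticeApprox δ (x i))) (𝓝[>] 0) (𝓝 (S 4 x)) :=
      (hlim 4).tendsto_at hx
    have h := h4.sub ((((hpair 0 1 (by decide)).mul (hpair 2 3 (by decide))).add
      ((hpair 0 2 (by decide)).mul (hpair 1 3 (by decide)))).add
      ((hpair 0 3 (by decide)).mul (hpair 1 2 (by decide))))
    have hlim_eq : limitConnectedFour S x = S 4 x - (S 2 ![x 0, x 1] * S 2 ![x 2, x 3]
        + S 2 ![x 0, x 2] * S 2 ![x 1, x 3] + S 2 ![x 0, x 3] * S 2 ![x 1, x 2]) := rfl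
    rw [hlim_eq]
    refine Tendsto.congr (fun δ => ?_) h
    simp only [hU]
    ring
  -- `U δ` is `ρ(δ)⁴` times the lattice Ursell function
  have hUeq : ∀ δ, U δ = ρ δ ^ 4 * ursellFour J β (latticeApprox δ (x 0)) (latticeApprox δ (x 1))
      (latticeApprox δ (x 2)) (latticeApprox δ (x 3)) := by
    intro δ
    simp only [hU, hGf, state_spinMonomial_pair, state_spinMonomial_four, ursellFour]
    ring
  /- Step 2: constants and the compact family of pair configurations (as in the `d ≥ 5` pointwise
  triviality theorem of the tree). -/
  set x' : Fin 4 → (Fin 3 → ℝ) := fun i => WithLp.ofLp (x i) with hx'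
  have hx'inj : ∀ i j, i ≠ j → x' i ≠ x' j := fun i j hij h =>
    hij (hinj ((WithLp.ofLp_injective 2) h))
  set prs : Finset (Fin 4 × Fin 4) := Finset.univ.filter (fun q => q.1 ≠ q.2) with hprs
  have h01 : ((0 : Fin 4), (1 : Fin 4)) ∈ prs := Finset.mem_filter.2 ⟨Finset.mem_univ _, by decide⟩
  obtain ⟨r₀, hr₀⟩ : ∃ r : ℝ, r = prs.inf' ⟨_, h01⟩ (fun q => ‖x' q.1 - x' q.2‖) := ⟨_, rfl⟩
  have hr₀le : ∀ i j, i ≠ j → r₀ ≤ ‖x' i - x' j‖ := fun i j hij => by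
    rw [hr₀]
    exact Finset.inf'_le (fun q : Fin 4 × Fin 4 => ‖x' q.1 - x' q.2‖)
      (Finset.mem_filter.2 ⟨Finset.mem_univ (i, j), hij⟩)
  have hr₀pos : 0 < r₀ := by
    rw [hr₀, Finset.lt_inf'_iff]
    intro q hq
    exact norm_pos_iff.2 (sub_ne_zero.2 (hx'inj q.1 q.2 (Finset.mem_filter.1 hq).2))
  obtain ⟨a, ha⟩ : ∃ a : ℝ, a = r₀ / 5 := ⟨_, rfl⟩
  have ha0 : 0 < a := by rw [ha]; positivity
  have h4a : 4 * a < r₀ := by rw [ha]; linarith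
  -- the reference point `p₀ = e₁` and the far radius `B`
  set k₀ : Fin 3 := ⟨0, hd1⟩ with hk₀
  set p₀ : EuclideanSpace ℝ (Fin 3) := WithLp.toLp 2 (Pi.single k₀ (1 : ℝ)) with hp₀
  have hp₀ne : p₀ ≠ 0 := by
    intro h
    have h1 : (WithLp.ofLp p₀) k₀ = 0 := by rw [h]; rfl
    simp [hp₀] at h1
  have hp₀norm : ‖WithLp.ofLp p₀‖ ≤ 1 := by
    rw [pi_norm_le_iff_of_nonneg zero_le_one]
    intro k
    simp only [hp₀, WithLp.ofLp_toLp]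
    by_cases hk : k = k₀
    · subst hk; simp
    · simp [Pi.single_eq_of_ne hk]
  obtain ⟨X, hX⟩ : ∃ X : ℝ, X = ∑ i, ‖x' i‖ := ⟨_, rfl⟩
  have hX0 : 0 ≤ X := by rw [hX]; exact Finset.sum_nonneg fun i _ => norm_nonneg _
  have hXi : ∀ i, ‖x' i‖ ≤ X := fun i => by
    rw [hX]
    exact Finset.single_le_sum (f := fun i => ‖x' i‖) (fun i _ => norm_nonneg _) (Finset.mem_univ i)
  obtain ⟨B, hBdef⟩ : ∃ B : ℝ, B = 2 * X + 4 * 3 + 4 := ⟨_, rfl⟩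
  have hB4 : 4 ≤ B := by rw [hBdef]; linarith
  have hB0 : 0 < B := by linarith
  -- the compact set of pair configurations
  set ΨA : Fin 4 → Fin 4 → (Fin 3 → ℝ) → (Fin 2 → EuclideanSpace ℝ (Fin 3)) :=
    fun i j w => ![x j, x i + WithLp.toLp 2 w] with hΨA
  set ΨB : Fin 4 → (Fin 3 → ℝ) → (Fin 2 → EuclideanSpace ℝ (Fin 3)) :=
    fun i w => ![x i, (0 : EuclideanSpace ℝ (Fin 3)) + WithLp.toLp 2 w] with hΨB
  set KA : Set (Fin 2 → EuclideanSpace ℝ (Fin 3)) :=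
    ⋃ i, ⋃ j, ⋃ (_ : i ≠ j), ΨA i j '' Metric.closedBall 0 (2 * a) with hKA
  set KB : Set (Fin 2 → EuclideanSpace ℝ (Fin 3)) :=
    ⋃ i, ΨB i '' (Metric.closedBall 0 (B + 1) ∩ {w | a / 2 ≤ ‖w - x' i‖}) with hKB
  set K : Set (Fin 2 → EuclideanSpace ℝ (Fin 3)) :=
    KA ∪ KB ∪ {![(0 : EuclideanSpace ℝ (Fin 3)), p₀]} with hK
  have hKc : IsCompact K := by
    refine (IsCompact.union ?_ ?_).union isCompact_singleton
    · refine isCompact_iUnion fun i => isCompact_iUnion fun j => isCompact_iUnion fun _ => ?_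
      exact (isCompact_closedBall _ _).image (continuous_pair_add_toLp _ _)
    · refine isCompact_iUnion fun i => ?_
      refine ((isCompact_closedBall _ _).inter_right ?_).image (continuous_pair_add_toLp _ _)
      exact isClosed_le continuous_const ((continuous_id.sub continuous_const).norm)
  have hKs : K ⊆ NonCoincident 3 2 := by
    intro z hz
    rcases hz with (hz | hz) | hz
    · simp only [hKA, Set.mem_iUnion, Set.mem_image] at hz
      obtain ⟨i, j, hij, w, hw, rfl⟩ := hz
      refine pair_mem_nonCoincident fun h => ?_
      have h' : x' j - x' i = w := by
        have h2 := congrArg WithLp.ofLp h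
        simp only [WithLp.ofLp_add] at h2
        simp only [hx']
        rw [h2, add_sub_cancel_left]
      have h1 := hr₀le j i (Ne.symm hij)
      rw [h'] at h1
      have h2 : ‖w‖ ≤ 2 * a := mem_closedBall_zero_iff.1 hw
      linarith
    · simp only [hKB, Set.mem_iUnion, Set.mem_image] at hz
      obtain ⟨i, w, ⟨-, hw2⟩, rfl⟩ := hz
      refine pair_mem_nonCoincident fun h => ?_
      have h' : w - x' i = 0 := by
        have h2 := congrArg WithLp.ofLp h
        simp only [WithLp.ofLp_toLp, zero_add] at h2
        simp only [hx']
        rw [h2, sub_self]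
      have h3 : a / 2 ≤ ‖w - x' i‖ := hw2
      rw [h', norm_zero] at h3
      linarith
    · rw [Set.mem_singleton_iff] at hz
      subst hz
      exact pair_mem_nonCoincident (Ne.symm hp₀ne)
  /- Step 3: the inputs — the uniform bound on `K`, the bubble and its tail. -/
  have hG1 : ∀ y : Fin 2 → Site 3, |Gf 2 y| ≤ 1 := fun y => by
    simp only [hGf, state_spinMonomial_two_fun]
    exact abs_pairCorrelation_le_one J β hβ hJ _ _
  obtain ⟨M₀, hM₀⟩ := exists_eventually_rescaled_two_le_of_abs_le_one hG1 hlim hKc hKs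
  obtain ⟨M, hM⟩ : ∃ M : ℝ, M = max M₀ 0 := ⟨_, rfl⟩
  have hMnn : 0 ≤ M := by rw [hM]; exact le_max_right _ _
  have hM₀M : M₀ ≤ M := by rw [hM]; exact le_max_left _ _
  obtain ⟨Bub, hBub⟩ : ∃ Bub : ℝ, Bub = ∑' v, G v ^ 2 := ⟨_, rfl⟩
  obtain ⟨Tf, hTf⟩ : ∃ Tf : ℝ → ℝ, Tf = fun δ => ∑' v, G v ^ 2 - ∑ v ∈ box 3 ⌊a / δ⌋₊, G v ^ 2 :=
    ⟨_, rfl⟩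
  have hTf0 : ∀ δ, 0 ≤ Tf δ := fun δ => by rw [hTf]; exact tsum_sq_sub_sum_box_nonneg hGs _
  obtain ⟨E, hE⟩ : ∃ E : ℝ → ℝ, E = fun δ => 2 * (M ^ 2 * (4 * (Real.sqrt Bub * Real.sqrt (Tf δ)) + Tf δ)) :=
    ⟨_, rfl⟩
  have hE0 : ∀ δ, 0 ≤ E δ := fun δ => by rw [hE]; have := hTf0 δ; positivity
  have hsmall : ∀ᶠ δ in 𝓝[>] (0 : ℝ), 0 < δ ∧ δ ≤ min (a / 2) 1 := by
    have h1 : ∀ᶠ δ in 𝓝[>] (0 : ℝ), δ < min (a / 2) 1 :=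
      (eventually_lt_nhds (by positivity)).filter_mono nhdsWithin_le_nhds
    filter_upwards [h1, (eventually_mem_nhdsWithin : ∀ᶠ δ in 𝓝[>] (0 : ℝ), δ ∈ Set.Ioi 0)]
      with δ h1 h2
    exact ⟨h2, h1.le⟩
  /- Step 4: the eventual bound `|U δ| ≤ E δ`. -/
  have hbound : ∀ᶠ δ in 𝓝[>] (0 : ℝ), |U δ| ≤ E δ := by
    filter_upwards [hM₀, hsmall] with δ hMδ hδ'
    obtain ⟨hδ, hδle⟩ := hδ'
    have hδa2 : δ ≤ a / 2 := hδle.trans (min_le_left _ _)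
    have hδ1 : δ ≤ 1 := hδle.trans (min_le_right _ _)
    have hδa : δ ≤ a := by linarith
    by_cases hρ : ρ δ = 0
    · rw [hUeq, hρ]
      simp only [ne_eq, OfNat.ofNat_ne_zero, not_false_eq_true, zero_pow, zero_mul, abs_zero]
      exact hE0 δ
    have hρ2 : 0 < ρ δ ^ 2 := by positivity
    obtain ⟨m, hm⟩ : ∃ m : ℝ, m = M * (ρ δ ^ 2)⁻¹ := ⟨_, rfl⟩
    have hm0 : 0 ≤ m := by rw [hm]; exact mul_nonneg hMnn (inv_nonneg.2 hρ2.le)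
    -- values of the two-point function read off the compact `K`
    have hGK : ∀ z ∈ K, G (latticeApprox δ (z 0) - latticeApprox δ (z 1)) ≤ m := by
      intro z hz
      have h := hMδ z hz
      simp only [hGf, state_spinMonomial_two_fun, hGpair] at h
      have h' := h.trans hM₀M
      calc G (latticeApprox δ (z 0) - latticeApprox δ (z 1))
          = (ρ δ ^ 2)⁻¹ * (ρ δ ^ 2 * G (latticeApprox δ (z 0) - latticeApprox δ (z 1))) := by
            rw [← mul_assoc, inv_mul_cancel₀ hρ2.ne', one_mul]
        _ ≤ (ρ δ ^ 2)⁻¹ * M := mul_le_mul_of_nonneg_left h' (inv_nonneg.2 hρ2.le)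
        _ = m := by rw [hm, mul_comm]
    -- (A): near a marked point, the factors at the other marked points are `≤ m`
    have hA : ∀ i j, i ≠ j → ∀ u, Site.supNorm (u - latticeApprox δ (x i)) ≤ ⌊a / δ⌋₊ →
        G (latticeApprox δ (x j) - u) ≤ m := by
      intro i j hij u hu
      set w : Fin 3 → ℝ := WithLp.ofLp (δ • siteVec u) - x' i with hw
      have hwn : ‖w‖ ≤ 2 * a := norm_rescaled_sub_le_of_supNorm_le hδ hδa (x i) u hu
      have hz : ΨA i j w ∈ K := by
        refine Or.inl (Or.inl ?_)
        simp only [hKA, Set.mem_iUnion, Set.mem_image]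
        exact ⟨i, j, hij, w, mem_closedBall_zero_iff.2 hwn, rfl⟩
      have h := hGK _ hz
      have e1 : ΨA i j w 1 = δ • siteVec u := by
        simp only [hΨA, Matrix.cons_val_one, Matrix.cons_val_zero]
        exact add_toLp_ofLp_sub _ _
      have e0 : ΨA i j w 0 = x j := by simp only [hΨA, Matrix.cons_val_zero]
      rwa [e1, e0, latticeApprox_smul_siteVec hδ] at h
    -- the near neighbourhoods of distinct marked points are disjoint
    have hsep : ∀ i j, i ≠ j → ∀ u : Site 3, Site.supNorm (u - latticeApprox δ (x i)) ≤ ⌊a / δ⌋₊ →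
        ⌊a / δ⌋₊ < Site.supNorm (latticeApprox δ (x j) - u) := by
      intro i j hij u hu
      by_contra hcon
      push Not at hcon
      rw [Site.supNorm_sub_comm] at hcon
      have h1 : ‖WithLp.ofLp (δ • siteVec u) - x' i‖ ≤ 2 * a :=
        norm_rescaled_sub_le_of_supNorm_le hδ hδa (x i) u hu
      have h2 : ‖WithLp.ofLp (δ • siteVec u) - x' j‖ ≤ 2 * a :=
        norm_rescaled_sub_le_of_supNorm_le hδ hδa (x j) u hcon
      have h3 : ‖x' i - x' j‖ ≤ 4 * a := by
        calc ‖x' i - x' j‖ = ‖(WithLp.ofLp (δ • siteVec u) - x' j) - (WithLp.ofLp (δ • siteVec u) - x' i)‖ := by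
              congr 1; abel
          _ ≤ ‖WithLp.ofLp (δ • siteVec u) - x' j‖ + ‖WithLp.ofLp (δ • siteVec u) - x' i‖ := norm_sub_le _ _
          _ ≤ 2 * a + 2 * a := add_le_add h2 h1
          _ = 4 * a := by ring
      linarith [hr₀le i j hij]
    -- (B): in the bulk, all factors are `≤ m`
    have hBr : ∀ u, Site.supNorm u ≤ ⌊B / δ⌋₊ →
        (∀ i, ⌊a / δ⌋₊ < Site.supNorm (u - latticeApprox δ (x i))) →
        ∀ i, G (latticeApprox δ (x i) - u) ≤ m := by
      intro u hu hfar i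
      set w : Fin 3 → ℝ := WithLp.ofLp (δ • siteVec u) with hw
      have hw1 : ‖w‖ ≤ B + 1 :=
        (norm_rescaled_le_of_supNorm_le hδ hB0.le u hu).trans (by linarith)
      have hw2 : a / 2 ≤ ‖w - x' i‖ :=
        le_norm_rescaled_sub_of_lt_supNorm hd1 hδ hδa2 (x i) u (hfar i)
      have hz : ΨB i w ∈ K := by
        refine Or.inl (Or.inr ?_)
        simp only [hKB, Set.mem_iUnion, Set.mem_image]
        exact ⟨i, w, ⟨mem_closedBall_zero_iff.2 hw1, hw2⟩, rfl⟩
      have h := hGK _ hz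
      have e1 : ΨB i w 1 = δ • siteVec u := by
        simp only [hΨB, Matrix.cons_val_one, Matrix.cons_val_zero, zero_add]
        rfl
      have e0 : ΨB i w 0 = x i := by simp only [hΨB, Matrix.cons_val_zero]
      rwa [e1, e0, latticeApprox_smul_siteVec hδ] at h
    -- the reference value `G([p₀/δ]) ≤ m`
    have hw0 : G (latticeApprox δ p₀) ≤ m := by
      have hz : (![(0 : EuclideanSpace ℝ (Fin 3)), p₀] : Fin 2 → _) ∈ K :=
        Or.inr (Set.mem_singleton _)
      have h := hGK _ hz
      simp only [Matrix.cons_val_one, Matrix.cons_val_zero] at h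
      have hz0 : latticeApprox δ (0 : EuclideanSpace ℝ (Fin 3)) = 0 := by
        funext k
        simp [latticeApprox_apply]
      rwa [hz0, zero_sub, hGsymm] at h
    -- (C): geometry of the far region
    have hsupy : ∀ i, (Site.supNorm (latticeApprox δ (x i)) : ℝ) ≤ X / δ + 1 := fun i =>
      (supNorm_latticeApprox_le hδ (x i)).trans (by gcongr; exact hXi i)
    have hsupw : (Site.supNorm (latticeApprox δ p₀) : ℝ) ≤ 1 / δ + 1 :=
      (supNorm_latticeApprox_le hδ p₀).trans (by gcongr)
    have hC2 : ∀ u, ⌊B / δ⌋₊ < Site.supNorm u → ∀ i,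
        Site.supNorm u ≤ 2 * Site.supNorm (latticeApprox δ (x i) - u) := by
      intro u hu i
      have hfloorB : B / δ < (⌊B / δ⌋₊ : ℝ) + 1 := Nat.lt_floor_add_one _
      have hu' : (⌊B / δ⌋₊ : ℝ) + 1 ≤ Site.supNorm u := by exact_mod_cast hu
      have h2y : 2 * Site.supNorm (latticeApprox δ (x i)) ≤ Site.supNorm u := by
        have h : (2 : ℝ) * Site.supNorm (latticeApprox δ (x i)) ≤ Site.supNorm u := by
          have h1 : (2 : ℝ) * (X / δ + 1) ≤ B / δ := by
            have e : 2 * (X / δ + 1) = (2 * X + 2 * δ) / δ := by field_simp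
            rw [e]
            refine div_le_div_of_nonneg_right ?_ hδ.le
            rw [hBdef]; linarith
          linarith [hsupy i]
        exact_mod_cast h
      have htri := Site.supNorm_le_supNorm_sub_add u (latticeApprox δ (x i))
      rw [Site.supNorm_sub_comm] at htri
      omega
    have hC1 : ∀ u, ⌊B / δ⌋₊ < Site.supNorm u → ∀ i,
        3 * Site.supNorm (latticeApprox δ p₀) ≤ Site.supNorm (latticeApprox δ (x i) - u) := by
      intro u hu i
      have hfloorB : B / δ < (⌊B / δ⌋₊ : ℝ) + 1 := Nat.lt_floor_add_one _
      have hu' : (⌊B / δ⌋₊ : ℝ) + 1 ≤ Site.supNorm u := by exact_mod_cast hu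
      have h2' : (Site.supNorm u : ℝ) ≤ 2 * Site.supNorm (latticeApprox δ (x i) - u) := by
        exact_mod_cast hC2 u hu i
      have h : (3 : ℝ) * Site.supNorm (latticeApprox δ p₀) ≤
          Site.supNorm (latticeApprox δ (x i) - u) := by
        have h1 : (3 : ℝ) * (1 / δ + 1) ≤ B / δ / 2 := by
          rw [div_div, le_div_iff₀ (by positivity)]
          have e : (3 : ℝ) * (1 / δ + 1) * (δ * 2) = 2 * 3 + 2 * 3 * δ := by
            field_simp
          rw [e, hBdef]
          have : (3 : ℝ) * δ ≤ 3 := by nlinarith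
          linarith
        calc (3 : ℝ) * Site.supNorm (latticeApprox δ p₀) ≤ 3 * (1 / δ + 1) :=
              mul_le_mul_of_nonneg_left hsupw (by norm_num)
          _ ≤ B / δ / 2 := h1
          _ ≤ Site.supNorm u / 2 := by linarith
          _ ≤ Site.supNorm (latticeApprox δ (x i) - u) := by linarith
      exact_mod_cast h
    -- (F): far from all marked points, every factor is `≤ m` (bulk by `K`, beyond by MMS2)
    have hF : ∀ u : Site 3, (∀ i, ⌊a / δ⌋₊ < Site.supNorm (u - latticeApprox δ (x i))) →
        G (latticeApprox δ (x 0) - u) ≤ m ∧ G (latticeApprox δ (x 1) - u) ≤ m := by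
      intro u hfar
      by_cases hu : Site.supNorm u ≤ ⌊B / δ⌋₊
      · exact ⟨hBr u hu hfar 0, hBr u hu hfar 1⟩
      · push Not at hu
        exact ⟨(hMMS _ _ (hC1 u hu 0)).trans hw0, (hMMS _ _ (hC1 u hu 1)).trans hw0⟩
    -- assembling the tree diagram bound
    have hB' : ∀ L : ℕ, ∑ u ∈ box 3 L, ∏ j, pairCorrelation J β (latticeApprox δ (x j)) u ≤
        m ^ 2 * (4 * (Real.sqrt Bub * Real.sqrt (Tf δ)) + Tf δ) := by
      intro L
      have h := sum_box_prod_four_le_of_summable_sq hG0 hGs (fun i => latticeApprox δ (x i)) ⌊a / δ⌋₊ m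
        hsep hA hF L
      rw [hBub, hTf]
      refine le_trans (le_of_eq ?_) h
      refine Finset.sum_congr rfl fun u _ => Finset.prod_congr rfl fun j _ => ?_
      exact hGpair _ _
    have hU4 := abs_ursellFour_le_of_sum_box_le J β hβ hJ (fun i => latticeApprox δ (x i)) hB'
    rw [hUeq, abs_mul, abs_of_nonneg (by positivity : (0 : ℝ) ≤ ρ δ ^ 4)]
    have hρm : ρ δ ^ 4 * m ^ 2 = M ^ 2 := by
      rw [hm]
      field_simp
    calc ρ δ ^ 4 * |ursellFour J β (latticeApprox δ (x 0)) (latticeApprox δ (x 1)) (latticeApprox δ (x 2))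
          (latticeApprox δ (x 3))|
        ≤ ρ δ ^ 4 * (2 * (m ^ 2 * (4 * (Real.sqrt Bub * Real.sqrt (Tf δ)) + Tf δ))) :=
          mul_le_mul_of_nonneg_left hU4 (by positivity)
      _ = 2 * ((ρ δ ^ 4 * m ^ 2) * (4 * (Real.sqrt Bub * Real.sqrt (Tf δ)) + Tf δ)) := by ring
      _ = E δ := by rw [hρm, hE]
  /- Step 5: the majorant tends to `0` (the bubble tail beyond `a/δ` vanishes as `δ → 0`). -/
  have hEt : Tendsto E (𝓝[>] 0) (𝓝 0) := by
    have hdiv : Tendsto (fun δ : ℝ => a / δ) (𝓝[>] 0) atTop := by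
      simp_rw [div_eq_mul_inv]
      exact tendsto_inv_nhdsGT_zero.const_mul_atTop ha0
    have hfl : Tendsto (fun δ : ℝ => ⌊a / δ⌋₊) (𝓝[>] 0) atTop := tendsto_nat_floor_atTop.comp hdiv
    have hT : Tendsto Tf (𝓝[>] 0) (𝓝 0) := by
      rw [hTf]
      exact (tendsto_tsum_sub_sum_box_atTop hGs).comp hfl
    have hsq : Tendsto (fun δ => Real.sqrt (Tf δ)) (𝓝[>] 0) (𝓝 0) := by
      simpa using hT.sqrt
    rw [hE]
    simpa using ((((hsq.const_mul (Real.sqrt Bub)).const_mul 4).add hT).const_mul (M ^ 2)).const_mul 2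
  have hU0 : Tendsto U (𝓝[>] 0) (𝓝 0) := by
    refine squeeze_zero_norm' ?_ hEt
    filter_upwards [hbound] with δ h1
    rw [Real.norm_eq_abs]
    exact h1
  exact tendsto_nhds_unique hU_tendsto hU0

/-- Corollary: under the bubble condition and MMS2, no pointwise scaling limit of the correlators has a
non-trivial connected four-point function (`¬ HasNontrivialU4 S`), whatever the renormalisation `ρ`.
[cite: Panis2023Triviality, Remark 1.6 and Theorem 12.2 (p. 51)] -/
theorem not_hasNontrivialU4_of_summable_sq (hβ : 0 ≤ β) (hJ : ∀ x y, 0 ≤ J x y)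
    (hJt : ∀ a x y, J (x + a) (y + a) = J x y)
    (hmms : ∀ x y : Site 3, (3 : ℝ) * ‖x‖ ≤ ‖y‖ → pairCorrelation J β 0 y ≤ pairCorrelation J β 0 x)
    (hB : Summable fun x : Site 3 => pairCorrelation J β 0 x ^ 2)
    {ρ : ℝ → ℝ} {S : CorrFamily 3}
    (hlim : HasPointwiseScalingLimit (fun _ y => state J β 0 (spinMonomial y)) ρ S) :
    ¬ HasNontrivialU4 S := by
  rintro ⟨x, hx, hne⟩
  exact hne (limitConnectedFour_eq_zero_of_summable_sq J β hβ hJ hJt hmms hB hlim x hx)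

/-- MMS2 at `β = 0` is trivial: the two-point function is the identity kernel. [folklore] -/
theorem mms_two_point_zero (x y : Site 3) (h : (3 : ℝ) * ‖x‖ ≤ ‖y‖) :
    pairCorrelation J 0 0 y ≤ pairCorrelation J 0 0 x := by
  rw [pairCorrelation_eq, pairCorrelation_eq, state_zero_pair_eq_ite, state_zero_pair_eq_ite]
  by_cases hy : (0 : Site 3) = y
  · have hy0 : ‖y‖ = 0 := by rw [← hy, norm_zero]
    have hx0 : ‖x‖ = 0 := le_antisymm (by linarith [norm_nonneg x]) (norm_nonneg x)
    rw [if_pos hy, if_pos (norm_eq_zero.1 hx0).symm]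
  · rw [if_neg hy]
    split_ifs <;> norm_num

end Pointwise

end LongRangeIsing

open LongRangeIsing

/-! ### The pointwise clause (iii) of the sub-problem is blocked under the bubble condition -/

/-- **At `β_c`: the bubble condition blocks the POINTWISE clause (iii) of `Ising3DConformalLimit`.** For a
ferromagnetic translation-invariant pair interaction `J ≥ 0` on `ℤ³` with MMS-monotone critical
two-point function (needed only when `β_c > 0`) and `B(β_c) < ∞`, every pointwise scaling limit `S` of
the critical correlators `⟨∏σ_{[xᵢ/δ]}⟩_{J,0,β_c}` — any renormalisation `ρ` — has `U₄^S ≡ 0` on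
non-coincident configurations; `β_c = 0` is the product measure. The hypotheses are exactly those of
the sharpened barrier `BubbleTrivialityOnZ3` (generation 2), whose conclusion was the smeared form only.
[cite: Panis2023Triviality, Remark 1.6 (p. 7) and Theorem 12.2 (p. 51)] -/
theorem limitConnectedFour_eq_zero_criticalBeta_of_summable_sq {J : Site 3 → Site 3 → ℝ}
    (hJ : ∀ x y, 0 ≤ J x y) (hJt : ∀ a x y, J (x + a) (y + a) = J x y)
    (hmms : 0 < LongRangeIsing.criticalBeta J → ∀ x y : Site 3, (3 : ℝ) * ‖x‖ ≤ ‖y‖ →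
      pairCorrelation J (LongRangeIsing.criticalBeta J) 0 y ≤ pairCorrelation J (LongRangeIsing.criticalBeta J) 0 x)
    (hB : Summable fun x : Site 3 => pairCorrelation J (LongRangeIsing.criticalBeta J) 0 x ^ 2)
    {ρ : ℝ → ℝ} {S : CorrFamily 3}
    (hlim : HasPointwiseScalingLimit
      (fun _ y => state J (LongRangeIsing.criticalBeta J) 0 (spinMonomial y)) ρ S) :
    ∀ x ∈ NonCoincident 3 4, limitConnectedFour S x = 0 := by
  have hmms' : ∀ x y : Site 3, (3 : ℝ) * ‖x‖ ≤ ‖y‖ →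
      pairCorrelation J (LongRangeIsing.criticalBeta J) 0 y ≤ pairCorrelation J (LongRangeIsing.criticalBeta J) 0 x := by
    rcases (criticalBeta_nonneg J).eq_or_lt with h0 | hpos
    · intro x y h
      rw [← h0]
      exact mms_two_point_zero J x y h
    · exact hmms hpos
  intro x hx
  exact limitConnectedFour_eq_zero_of_summable_sq J _ (criticalBeta_nonneg J) hJ hJt hmms' hB hlim x hx

/-- **The catalogued barrier at the pointwise level** (scope caveat (a) of `LongRangeTrivialityOnZ3`
lifted for `U₄`): on `ℤ³`, for `J_{x,y} = C₀|x-y|₁^{-3-α}` with `0 < α < 3/2`, every pointwise scaling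
limit `S` of the critical correlators `ρ(δ)ⁿ⟨∏σ_{[xᵢ/δ]}⟩_{β_c}` — ANY renormalisation `ρ`, no
non-degeneracy of `S₂` assumed — fails clause (iii) of the sub-problem: `¬ HasNontrivialU4 S`. Inputs:
`B(β_c) < ∞` (`summable_sq_pairCorrelation_criticalBeta`, from the infrared bound) and MMS2
(`panis_mms_two_point_monotone_holds`). [cite: Panis2023Triviality, Theorem 1.2 ("every sub-sequential scaling limit … is Gaussian") with Remark 1.6 and Theorem 12.2] -/
theorem LongRangeTrivialityOnZ3_pointwise {C₀ α : ℝ} (hC₀ : 0 < C₀) (hα : 0 < α) (hα' : α < 3 / 2)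
    {ρ : ℝ → ℝ} {S : CorrFamily 3}
    (hlim : HasPointwiseScalingLimit
      (fun _ y => state (algebraicCoupling 3 C₀ α) (LongRangeIsing.criticalBeta (algebraicCoupling 3 C₀ α)) 0
        (spinMonomial y)) ρ S) :
    ¬ HasNontrivialU4 S := by
  rintro ⟨x, hx, hne⟩
  exact hne (limitConnectedFour_eq_zero_criticalBeta_of_summable_sq (algebraicCoupling_nonneg hC₀.le α)
    (algebraicCoupling_add C₀ α)
    (fun hpos x y h => panis_mms_two_point_monotone_holds 3 (by norm_num) C₀ α hC₀ hα _ hpos x y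
      (by exact_mod_cast h))
    (summable_sq_pairCorrelation_criticalBeta hC₀ hα hα') hlim x hx)

/-- **The summit statement's exact shape, transported to the `α < 3/2` members, is false**: replacing the
nearest-neighbour critical correlators `criticalCorr 3` in `CritIsing3DConformalLimit` by those of
`C₀|x-y|₁^{-3-α}`, `0 < α < 3/2`, there are no `ρ > 0`, `Δ > 0`, `S` with a pointwise scaling limit,
non-degenerate `S₂`, Möbius covariance AND non-trivial `U₄` — already the last clause fails for every
pointwise limit. So an argument establishing `CritIsing3DConformalLimit` must, at the level of the pointwise
clause (iii) as well, consume an input failing for these members. [cite: Panis2023Triviality, Theorem 1.2 and Theorem 12.2] [cite: DuminilCopinICM2022, §8.1 p. 25 and §8.4 pp. 28–29 (the conformal-limit statement on ℤ³)] -/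
theorem not_conformalLimitShape_algebraic {C₀ α : ℝ} (hC₀ : 0 < C₀) (hα : 0 < α) (hα' : α < 3 / 2) :
    ¬ ∃ (ρ : ℝ → ℝ) (Δ : ℝ) (S : CorrFamily 3), (∀ δ ∈ Set.Ioc (0 : ℝ) 1, 0 < ρ δ) ∧ 0 < Δ ∧
      HasPointwiseScalingLimit
        (fun _ y => state (algebraicCoupling 3 C₀ α) (LongRangeIsing.criticalBeta (algebraicCoupling 3 C₀ α)) 0
          (spinMonomial y)) ρ S ∧
      IsNondegenerateTwoPoint S ∧ IsMoebiusCovariant Δ S ∧ HasNontrivialU4 S := by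
  rintro ⟨ρ, Δ, S, -, -, hlim, -, -, hU4⟩
  exact LongRangeTrivialityOnZ3_pointwise hC₀ hα hα' hlim hU4

/-- **"Some pointwise scaling limit of the critical correlators has `U₄ ≢ 0`" is not interaction-uniform
on `ℤ³`**: it fails for the member `α = 1` (`C₀ = 1`) of `Z3Model`. This is the pointwise companion of
`LongRangeTrivialityOnZ3.not_interactionUniformZ3` (smeared form). [cite: Panis2023Triviality, Theorem 1.2] -/
theorem not_interactionUniformZ3_pointwiseU4 :
    ¬ InteractionUniformZ3 fun m => ∃ (ρ : ℝ → ℝ) (S : CorrFamily 3),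
      HasPointwiseScalingLimit
        (fun _ y => state m.coupling (LongRangeIsing.criticalBeta m.coupling) 0 (spinMonomial y)) ρ S ∧
      HasNontrivialU4 S :=
  not_interactionUniformZ3_of_counterexample (.algebraic 1 1 one_pos one_pos) fun ⟨_, _, hlim, hU4⟩ =>
    LongRangeTrivialityOnZ3_pointwise one_pos one_pos (by norm_num) hlim hU4

/-- **Non-trivial pointwise `U₄` on `ℤ³` costs a divergent bubble** (pointwise companion of
`hasNonGaussianSmearingZ3_member_imp`): for any member of `Z3Model` with MMS-monotone critical two-point
function — the nearest-neighbour model included, granted MMS2 for it in this formalisation — a pointwise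
scaling limit of the critical correlators with `U₄ ≢ 0` forces `B(β_c) = ∑ₓ⟨σ₀σ_x⟩²_{β_c} = ∞`
(for the nearest-neighbour model on `ℤ³` this is Duminil-Copin–Panis's Theorem 1.8, so the class is left —
necessarily, not sufficiently). [cite: DuminilCopinPanis2025LowerBounds, Theorem 1.8] [cite: Panis2023Triviality, Theorem 12.2] -/
theorem hasNontrivialU4_member_imp (m : Z3Model)
    (hmms : 0 < LongRangeIsing.criticalBeta m.coupling → ∀ x y : Site 3, (3 : ℝ) * ‖x‖ ≤ ‖y‖ →
      pairCorrelation m.coupling (LongRangeIsing.criticalBeta m.coupling) 0 y ≤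
        pairCorrelation m.coupling (LongRangeIsing.criticalBeta m.coupling) 0 x)
    {ρ : ℝ → ℝ} {S : CorrFamily 3}
    (hlim : HasPointwiseScalingLimit
      (fun _ y => state m.coupling (LongRangeIsing.criticalBeta m.coupling) 0 (spinMonomial y)) ρ S)
    (hU4 : HasNontrivialU4 S) :
    ¬ Summable fun x : Site 3 => pairCorrelation m.coupling (LongRangeIsing.criticalBeta m.coupling) 0 x ^ 2 := by
  intro hB
  obtain ⟨x, hx, hne⟩ := hU4
  exact hne (limitConnectedFour_eq_zero_criticalBeta_of_summable_sq m.coupling_nonneg m.coupling_add hmms hB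
    hlim x hx)

/-- **"Finite critical bubble ⟹ pointwise `U₄ ≡ 0`" IS interaction-uniform on `Z3Model`** (MMS2 granted),
the pointwise companion of `interactionUniformZ3_bubble_triviality`. [cite: Panis2023Triviality, Remark 1.6 and Theorem 12.2] -/
theorem interactionUniformZ3_bubble_pointwiseTriviality :
    InteractionUniformZ3 fun m =>
      (0 < LongRangeIsing.criticalBeta m.coupling → ∀ x y : Site 3, (3 : ℝ) * ‖x‖ ≤ ‖y‖ →
        pairCorrelation m.coupling (LongRangeIsing.criticalBeta m.coupling) 0 y ≤
          pairCorrelation m.coupling (LongRangeIsing.criticalBeta m.coupling) 0 x) →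
      (Summable fun x : Site 3 => pairCorrelation m.coupling (LongRangeIsing.criticalBeta m.coupling) 0 x ^ 2) →
      ∀ (ρ : ℝ → ℝ) (S : CorrFamily 3),
        HasPointwiseScalingLimit
          (fun _ y => state m.coupling (LongRangeIsing.criticalBeta m.coupling) 0 (spinMonomial y)) ρ S →
        ¬ HasNontrivialU4 S :=
  fun m hmms hB _ _ hlim hU4 => hasNontrivialU4_member_imp m hmms hlim hU4 hB

end Literature.Barriers.CriticalPhenomena

end
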